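import Literature.MathematicalPhysics.QuantumFieldTheory.Balaban1983to89.B6Eq291Generator

/-!
# `Balaban1983to89.B6Eq291Transpose` — T. Bałaban, *Propagators and renormalization transformations for lattice gauge theories. II*,
# Commun. Math. Phys. **96** (1984) 223–250 [Balaban1984PropagatorsII], eq. (2.91) p. 239 READ FROM THE RIGHT: `G₀Δ_a = I − R̃`,
# `R̃ = Σ_{□,□′} h_{□′}G_{□′}K̃_{□,□′}` with every product of (2.92)–(2.93) reversed — the resolvent identity behind the right-factor entry
# `|(G∇*J)(x)|` of Prop. 2.6 (2.136), ring-generically, as the image of p02's `…B6Eq291Generator.eq291` in the opposite ring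

statement-level skeleton of published theorems with citation tags; proofs where landed; nothing here is a claim about the Yang–Mills mass gap

PDF held: `paper:balaban1984-cmp96-propagators-rt-ii` (journal page = PDF page + 222); p. 239 [PDF 17] ((2.90)–(2.93)) and p. 247 [PDF 25] ((2.136), (2.141))
re-read this generation on the ×2 renders `b2b-balaban-ref1/pages/1984-cmp96-propagators-rt-II/…-p017-x2.png`, `…-p025-x2.png`.

CITATION HEADER (lean-in-tree rule) — WHAT IS REPRODUCED.  Phase-2 file of the `lit-balaban` typed skeleton (HOME `run/shared/lean/pub/lit-balaban/`), seat
**p38 gen 31**, brick 2 of the programme «(2.136)₃ by the transposed walk» (HOME/STATUS.md 2026-08-23T16:53:34Z; brick 1 = `…B6Prop26RightChainGeneric`);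
SKELETON rows **B6.Eq2.91** × B6.Eq2.92 × B6.Eq2.93 × B6.Prop2.6 (cells only; decls of record — p02's `eq291`, `kDiag`, `kOff` — untouched).
Print derives (2.91) `Δ_aG₀ = I − Σ_{□,□′}K_{□,□′}G_{□′}h_{□′}` from `G₀ = Σ_□ h_□G_□h_□`, the partition `Σ_□h_□² = 1` (2.36), the local inverses (2.90) and the
cut-offs `ζ_□`; p02's `…B6Eq291Generator.eq291` proves it in an arbitrary ring from five one-sided hypotheses (`Mh_□ = m_□h_□`, `(m_□ − p_□)g_□h_□ = h_□`,
`ζ_□h_□ = h_□ = h_□ζ_□`).  Since `Δ_a`, `G₀`, `G` are symmetric, the same computation run from the right gives **`G₀Δ_a = I − R̃`**, `R̃ = Rᵀ`; THIS FILE obtains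
it WITHOUT any symmetry hypothesis, as the literal image of `eq291` in the opposite ring `𝔄ᵐᵒᵖ` (Mathlib's `MulOpposite`): the reversed kernels
**`kDiagT`** `:= (m·h − h·m) + h·(∂P∂* − p)·ζ + (h·p − p·h)·ζ` ((2.92) reversed), **`kOffT`** `:= h_{□′}·∂P∂*·(1 − ζ_{□′})·h_□·h_□` ((2.93) reversed, derived
index), **`kFamT`**, **`rOpT`** `:= Σ_□Σ_{□′} h_{□′}g_{□′}K̃_{□,□′}`; `op_kDiagT`/`op_kOffT`/`op_kFamT` (their images under `MulOpposite.op` ARE p02's kernels of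
the opposite ring); **`eq291T`** / **`eq291T_sum`**: under `Σh_□² = 1`, `h_□M = h_□m_□`, `h_□g_□(m_□ − p_□) = h_□`, `ζ_□h_□ = h_□ = h_□ζ_□`,
`G₀·(M − ∂P∂*) = 1 − R̃`; **`leftFixedPointT`** (`Δ_aG = 1` ⟹ `G = G₀ + R̃G`); `kFamT_smul` (degree-one homogeneity, the unit bookkeeping of p38's
`kFam_smul`); `kDiagT_noDomainChange`, `kOffT_noDomainChange`; and the window dictionary read from the right, **`hinvT_of_window`** /
**`hinvT_of_window'`** (`G_□Δ_{a,□} = 1` on `T_□` and `h_□·(E∘R) = h_□` ⟹ `h_□·g_□·(m_□ − p_□) = h_□` for the transported operators).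
DEFINITIONS + THEOREMS, all proved (0 sorry); no `def … : Prop`; standard axioms.

HONEST SCOPE / DIVERGENCES.  (1) Print states (2.91) only in the left form; the right form is what the symmetric operators of the paper also satisfy and what
the right-factor entries of (2.136)/(2.67) need (*"The similar inequalities hold …"* p. 234) — recorded in HOME/GAPS.md as an unprinted step, not a gap in
print's mathematics.  (2) As in p02's file, nothing here knows what `M`, `∂P∂*`, `h_□`, `ζ_□`, `G_□` are: the hypotheses `hagreeT`, `hinvT` for the genuine V1
operators (locality of `Δ + Q*aQ` read at OUTPUT points of `supp h_□`; the two-sided local inverse) are the consumer's (next files of the programme).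
(3) The off-diagonal kernel carries the DERIVED index `ζ_{□′}` (p02's finding: the printed `ζ_□` makes (2.93) vanish identically, `printed293_fails`).
Pure algebra; nothing on d = 4 or the continuum; NOT summit progress.  Unit `lit-balaban-p38` (gen 31), 2026-08-23.
-/

namespace Literature.MathematicalPhysics.QuantumFieldTheory.Balaban1983to89.B6Eq291Transpose

open Literature.MathematicalPhysics.QuantumFieldTheory.Balaban1983to89.B6Eq291Generator (kDiag kOff kFam gZero eq291_sum transport)
open MulOpposite

/-! ## §1  The reversed kernels and (2.91) from the right, in any ring -/

section Ring

variable {𝔄 : Type*} [Ring 𝔄] {ι : Type*}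

/-- **(2.92) REVERSED, `K̃_{□,□}`**: `(m·h_□ − h_□·m) + h_□(∂P∂* − ∂P_□∂*)ζ_□ + (h_□·∂P_□∂* − ∂P_□∂*·h_□)ζ_□` — every product of p02's `kDiag` in the
opposite order (the kernel that multiplies `h_□G_□` FROM THE RIGHT in `R̃`). [cite: Balaban1984PropagatorsII, (2.92) p.239] -/
def kDiagT (Dg h z m p : 𝔄) : 𝔄 := (m * h - h * m) + h * (Dg - p) * z + (h * p - p * h) * z

/-- **(2.93) REVERSED, `K̃_{□,□′}` (□ ≠ □′)**: `h_{□′}·∂P∂*·(1 − ζ_{□′})·h_□·h_□` (derived index `ζ_{□′}`, as in p02's `kOff`).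
[cite: Balaban1984PropagatorsII, (2.93) p.239] -/
def kOffT (Dg hi zj hj : 𝔄) : 𝔄 := hj * Dg * (1 - zj) * hi * hi

/-- The reversed family `K̃_{□,□′}`. [cite: Balaban1984PropagatorsII, (2.91)–(2.93) p.239] -/
def kFamT [DecidableEq ι] (Dg : 𝔄) (h z m p : ι → 𝔄) (i j : ι) : 𝔄 :=
  if i = j then kDiagT Dg (h j) (z j) (m j) (p j) else kOffT Dg (h i) (z j) (h j)

/-- **`R̃ = Σ_{□,□′∈𝒟} h_{□′}G_{□′}K̃_{□,□′}`**, the transposed (2.91)-operator. [cite: Balaban1984PropagatorsII, (2.91) p.239] -/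
def rOpT [DecidableEq ι] (s : Finset ι) (Dg : 𝔄) (h z g m p : ι → 𝔄) : 𝔄 :=
  ∑ i ∈ s, ∑ j ∈ s, h j * g j * kFamT Dg h z m p i j

/-- unfolding of `K̃_{□,□}`. [cite: Balaban1984PropagatorsII, (2.92) p.239] -/
theorem kDiagT_def (Dg h z m p : 𝔄) : kDiagT Dg h z m p = (m * h - h * m) + h * (Dg - p) * z + (h * p - p * h) * z := rfl

/-- unfolding of `K̃_{□,□′}`. [cite: Balaban1984PropagatorsII, (2.93) p.239] -/
theorem kOffT_def (Dg hi zj hj : 𝔄) : kOffT Dg hi zj hj = hj * Dg * (1 - zj) * hi * hi := rfl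

/-- the diagonal members of the reversed family. [cite: Balaban1984PropagatorsII, (2.91)–(2.92) p.239] -/
theorem kFamT_of_eq [DecidableEq ι] (Dg : 𝔄) (h z m p : ι → 𝔄) (i : ι) :
    kFamT Dg h z m p i i = kDiagT Dg (h i) (z i) (m i) (p i) := by
  simp [kFamT]

/-- the off-diagonal members of the reversed family. [cite: Balaban1984PropagatorsII, (2.91), (2.93) p.239] -/
theorem kFamT_of_ne [DecidableEq ι] (Dg : 𝔄) (h z m p : ι → 𝔄) {i j : ι} (hij : i ≠ j) :
    kFamT Dg h z m p i j = kOffT Dg (h i) (z j) (h j) := by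
  simp [kFamT, hij]

/-- `op K̃_{□,□} = K_{□,□}` of the opposite ring. [cite: Balaban1984PropagatorsII, (2.92) p.239] -/
theorem op_kDiagT (Dg h z m p : 𝔄) : op (kDiagT Dg h z m p) = kDiag (op Dg) (op h) (op z) (op m) (op p) := by
  simp only [kDiagT, kDiag, op_add, op_sub, op_mul, mul_assoc]

/-- `op K̃_{□,□′} = K_{□,□′}` of the opposite ring. [cite: Balaban1984PropagatorsII, (2.93) p.239] -/
theorem op_kOffT (Dg hi zj hj : 𝔄) : op (kOffT Dg hi zj hj) = kOff (op Dg) (op hi) (op zj) (op hj) := by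
  simp only [kOffT, kOff, op_sub, op_mul, op_one, mul_assoc]

/-- `op K̃ = K` of the opposite ring, for the whole family. [cite: Balaban1984PropagatorsII, (2.91)–(2.93) p.239] -/
theorem op_kFamT [DecidableEq ι] (Dg : 𝔄) (h z m p : ι → 𝔄) (i j : ι) :
    op (kFamT Dg h z m p i j) = kFam (op Dg) (fun i => op (h i)) (fun i => op (z i)) (fun i => op (m i)) (fun i => op (p i)) i j := by
  unfold kFamT kFam
  split_ifs <;> simp [op_kDiagT, op_kOffT]

/-- **(2.91) FROM THE RIGHT, EXPANDED: `(Σ_□ h_□G_□h_□)·Δ_a = 1 − Σ_□Σ_{□′} h_{□′}G_{□′}K̃_{□,□′}`** in any ring, from `Σ_□h_□² = 1` (2.36), `h_□M = h_□m_□`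
(`Δ + Q*aQ` agrees with its `T_□`-version at the OUTPUT points of `supp h_□`), `h_□g_□(m_□ − p_□) = h_□` ((2.90) read as a RIGHT inverse through the
window), `ζ_□h_□ = h_□ = h_□ζ_□` — p02's `eq291_sum` in `𝔄ᵐᵒᵖ`. [cite: Balaban1984PropagatorsII, (2.91) p.239, (2.36) p.229, (2.90) p.239] -/
theorem eq291T_sum [DecidableEq ι] (s : Finset ι) (M Dg : 𝔄) (h z g m p : ι → 𝔄)
    (hpart : ∑ i ∈ s, h i * h i = 1) (hagreeT : ∀ i ∈ s, h i * M = h i * m i)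
    (hinvT : ∀ i ∈ s, h i * g i * (m i - p i) = h i)
    (hzh : ∀ i ∈ s, z i * h i = h i) (hhz : ∀ i ∈ s, h i * z i = h i) :
    (∑ j ∈ s, h j * g j * h j) * (M - Dg) = 1 - ∑ i ∈ s, ∑ j ∈ s, h j * g j * kFamT Dg h z m p i j := by
  have H := eq291_sum (𝔄 := 𝔄ᵐᵒᵖ) s (op M) (op Dg) (fun i => op (h i)) (fun i => op (z i)) (fun i => op (g i))
    (fun i => op (m i)) (fun i => op (p i))
    (by rw [← op_one (α := 𝔄), ← hpart, Finset.op_sum]; simp only [← op_mul])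
    (fun i hi => by rw [← op_mul, ← op_mul, hagreeT i hi])
    (fun i hi => by rw [← op_sub, ← op_mul, ← op_mul, ← mul_assoc, hinvT i hi])
    (fun i hi => by rw [← op_mul, hhz i hi])
    (fun i hi => by rw [← op_mul, hzh i hi])
  apply op_injective
  rw [op_mul, op_sub, Finset.op_sum, op_sub, op_one, Finset.op_sum]
  simp only [op_mul, Finset.op_sum, op_kFamT, ← mul_assoc] at H ⊢
  exact H

/-- **(2.91) FROM THE RIGHT: `G₀·Δ_a = 1 − R̃`** (`G₀ = gZero`, `R̃ = rOpT`). [cite: Balaban1984PropagatorsII, (2.91) p.239] -/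
theorem eq291T [DecidableEq ι] (s : Finset ι) (M Dg : 𝔄) (h z g m p : ι → 𝔄)
    (hpart : ∑ i ∈ s, h i * h i = 1) (hagreeT : ∀ i ∈ s, h i * M = h i * m i)
    (hinvT : ∀ i ∈ s, h i * g i * (m i - p i) = h i)
    (hzh : ∀ i ∈ s, z i * h i = h i) (hhz : ∀ i ∈ s, h i * z i = h i) :
    gZero s h g * (M - Dg) = 1 - rOpT s Dg h z g m p :=
  eq291T_sum s M Dg h z g m p hpart hagreeT hinvT hzh hhz

/-- **THE LEFT FIXED-POINT FORM**: a RIGHT inverse `G` of `Δ_a` (`Δ_a·G = 1`) satisfies `G = G₀ + R̃·G` — the walk (2.141) read from the right, as the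
right-factor entry `G·∇*` of (2.136) needs it (`…B6Prop26RightChainGeneric.leftFixedPoint_of_291T`). [cite: Balaban1984PropagatorsII, (2.91) p.239, (2.141) p.247] -/
theorem leftFixedPointT {Da G G0 Rt : 𝔄} (hG : Da * G = 1) (h291T : G0 * Da = 1 - Rt) : G = G0 + Rt * G := by
  have e : (G0 * Da) * G = (1 - Rt) * G := by rw [h291T]
  rw [mul_assoc, hG, mul_one, sub_mul, one_mul] at e
  rw [e, sub_add_cancel]

/-- `G = G₀ + R̃G` for the concrete `G₀`, `R̃`. [cite: Balaban1984PropagatorsII, (2.91) p.239, (2.141) p.247] -/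
theorem leftFixedPointT_eq291T [DecidableEq ι] (s : Finset ι) (M Dg G : 𝔄) (h z g m p : ι → 𝔄)
    (hG : (M - Dg) * G = 1)
    (hpart : ∑ i ∈ s, h i * h i = 1) (hagreeT : ∀ i ∈ s, h i * M = h i * m i)
    (hinvT : ∀ i ∈ s, h i * g i * (m i - p i) = h i)
    (hzh : ∀ i ∈ s, z i * h i = h i) (hhz : ∀ i ∈ s, h i * z i = h i) :
    G = gZero s h g + rOpT s Dg h z g m p * G :=
  leftFixedPointT hG (eq291T s M Dg h z g m p hpart hagreeT hinvT hzh hhz)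

/-- NO DOMAIN CHANGE: with `ζ_□ = 1`, `∂P_□∂* = ∂P∂*` the reversed diagonal kernel is the single commutator `Δ_ah_□ − h_□Δ_a` (the negative of p02's
`kDiag_noDomainChange`, as a transpose of a commutator must be). [cite: Balaban1984PropagatorsII, (2.38) p.229 + (2.92) p.239] -/
theorem kDiagT_noDomainChange (M Dg h : 𝔄) : kDiagT Dg h 1 M Dg = (M - Dg) * h - h * (M - Dg) := by
  simp only [kDiagT]
  noncomm_ring

/-- NO DOMAIN CHANGE: with `ζ_{□′} = 1` the reversed off-diagonal kernel vanishes. [cite: Balaban1984PropagatorsII, (2.93) p.239] -/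
theorem kOffT_noDomainChange (Dg hi hj : 𝔄) : kOffT Dg hi 1 hj = 0 := by
  simp [kOffT]

end Ring

/-! ## §2  Degree-one homogeneity (the unit bookkeeping) -/

section Smul

/-- **`K̃_{□,□′}` IS HOMOGENEOUS OF DEGREE ONE IN `(∂P∂*, M_□, P_□)`** (the mirror of p38's `…B6Prop26KLevelSkeletonV2.kFam_smul`).
[cite: Balaban1984PropagatorsII, (2.91)–(2.93) p.239] -/
theorem kFamT_smul {𝔄 : Type} [Ring 𝔄] [Algebra ℝ 𝔄] {ι : Type} [DecidableEq ι] (s : ℝ) (Dg : 𝔄) (h z M Pm : ι → 𝔄) (i j : ι) :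
    kFamT (s • Dg) h z (fun i => s • M i) (fun i => s • Pm i) i j = s • kFamT Dg h z M Pm i j := by
  unfold kFamT kDiagT kOffT
  split_ifs
  · simp only [smul_sub, smul_add, mul_smul_comm, smul_mul_assoc, mul_sub, sub_mul, mul_assoc]
  · simp only [mul_smul_comm, smul_mul_assoc, mul_assoc]

end Smul

/-! ## §3  The window dictionary read from the right -/

section Transport

variable {R : Type*} [CommRing R] {V W : Type*} [AddCommGroup V] [Module R V] [AddCommGroup W] [Module R W]

/-- transport is multiplicative when `Rr ∘ E = id`. [cite: Balaban1984PropagatorsII, (2.89)–(2.91) pp.238–239] -/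
private theorem transport_mul (E : W →ₗ[R] V) (Rr : V →ₗ[R] W) (hRE : Rr ∘ₗ E = LinearMap.id) (X Y : Module.End R W) :
    transport E Rr X * transport E Rr Y = transport E Rr (X * Y) := by
  apply LinearMap.ext
  intro v
  have hre : Rr (E (Y (Rr v))) = Y (Rr v) := by simpa using LinearMap.congr_fun hRE (Y (Rr v))
  simp only [transport, Module.End.mul_apply, LinearMap.coe_comp, Function.comp_apply, hre]

/-- transport is subtractive. [cite: Balaban1984PropagatorsII, (2.89)–(2.91) pp.238–239, bookkeeping] -/
private theorem transport_sub (E : W →ₗ[R] V) (Rr : V →ₗ[R] W) (X Y : Module.End R W) :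
    transport E Rr (X - Y) = transport E Rr X - transport E Rr Y := by
  simp only [transport, LinearMap.sub_comp, LinearMap.comp_sub]

/-- `transport 1 = E ∘ Rr`, the window idempotent. [cite: Balaban1984PropagatorsII, (2.89)–(2.91) pp.238–239, bookkeeping] -/
private theorem transport_one (E : W →ₗ[R] V) (Rr : V →ₗ[R] W) : transport E Rr 1 = E ∘ₗ Rr := by
  simp only [transport, Module.End.one_eq_id, LinearMap.id_comp]

/-- **`hinvT` FROM THE PRINTED STRUCTURE**: if `G_□Δ_{a,□} = 1` on the torus `T_□` ((2.90): `G_□` is THE inverse there, two-sided) and `h_□` reads only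
inside the window (`h_□ ∘ (E ∘ Rr) = h_□`), then for the transported operators `g := transport G_□`, `m − p := transport Δ_{a,□}`:
`h_□ * g * (m − p) = h_□`. [cite: Balaban1984PropagatorsII, (2.90)–(2.91) p.239] -/
theorem hinvT_of_window (E : W →ₗ[R] V) (Rr : V →ₗ[R] W) (hRE : Rr ∘ₗ E = LinearMap.id)
    (Gloc Dloc : Module.End R W) (hGloc : Gloc * Dloc = 1) (H : Module.End R V) (hwin : H ∘ₗ (E ∘ₗ Rr) = H) :
    H * transport E Rr Gloc * transport E Rr Dloc = H := by
  rw [mul_assoc, transport_mul E Rr hRE, hGloc, transport_one, Module.End.mul_eq_comp, hwin]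

/-- The transported generator split as printed: `h_□ * g * (transport m_loc − transport p_loc) = h_□`.
[cite: Balaban1984PropagatorsII, (2.90)–(2.91) p.239] -/
theorem hinvT_of_window' (E : W →ₗ[R] V) (Rr : V →ₗ[R] W) (hRE : Rr ∘ₗ E = LinearMap.id)
    (mloc ploc Gloc : Module.End R W) (hGloc : Gloc * (mloc - ploc) = 1) (H : Module.End R V)
    (hwin : H ∘ₗ (E ∘ₗ Rr) = H) :
    H * transport E Rr Gloc * (transport E Rr mloc - transport E Rr ploc) = H := by
  rw [← transport_sub]
  exact hinvT_of_window E Rr hRE Gloc (mloc - ploc) hGloc H hwin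

end Transport

end Literature.MathematicalPhysics.QuantumFieldTheory.Balaban1983to89.B6Eq291Transpose
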